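import Literature.NumberTheory.Irrationality.Zudilin2003.BrickDecomposition
import HarnessLib

/-!
# Zudilin 2003, Lemma 1 (arithmetic half, cont.): the denominators of `U_n, U'_n, U''_n, V_n`

Source: W. Zudilin, *An Apéry-like difference equation for Catalan's constant*, Electron. J. Combin.
10 (2003), #R14, arXiv:math/0201024 [Zudilin2003Catalan], Sect. 2, end of the proof of Lemma 1
((16), (18), (19) and the display after (19)).

HONEST FRAMING (cell `pub-zeta5`): systematic search; no irrationality claim unless certified.

With the partial-fraction data `c` of `16ⁿ R_n(τ+½)` from `BrickDecomposition.lean` (`A_{jk} = 16⁻ⁿ c_{2-j,k}`,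
`d^{2-o} c_{o,p} ∈ ℤ`), the coefficients (18)–(19) of Lemma 1 are
`U_n = 8·16⁻ⁿ Σ_k (-1)^k c_{2,k}`, `U'_n = 4·16⁻ⁿ Σ_k (-1)^k c_{1,k}`, `U''_n = 2·16⁻ⁿ Σ_k (-1)^k c_{0,k}`,
`V_n = 16⁻ⁿ Σ_{o<3} Σ_k (-1)^k c_{o,k} · Σ_{l<k} (-1)^l/(l+½)^{o+1}`
(`Σ_{l<k} (-1)^l/(l+½)^s = 2^s Σ_{l<k} (-1)^l/(2l+1)^s`). This file PROVES the source's
"finally, using the inclusions (16) and `D_{2n-1}^{3-j} Σ_{l<k} (-1)^l/(2l+1)^{3-j} ∈ ℤ` … we deduce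
`U_n, D_nU'_n, D_n²U''_n, D_{2n-1}³V_n ∈ 2^{-4n}ℤ`", for ANY data `c` with `BallRivoal.IsInt 3 d c`:

* `isInt_dpow_mul_altSum` — `d^{2-o} Σ_{k≤n} (-1)^k c_{o,k} ∈ ℤ` (so `2^{4n}U_n/8`, `2^{4n}d U'_n/4`,
  `2^{4n}d² U''_n/2 ∈ ℤ`);
* `altHalfPartial s k = Σ_{l<k} (-1)^l/(l+½)^s` and `isInt_lcmUpto_pow_mul_altHalfPartial` —
  `D_{2n-1}^s · Σ_{l<k} (-1)^l/(l+½)^s ∈ ℤ` for `k ≤ n`;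
* (private) `D_n ∣ D_{2n-1}` (`n ≥ 1`);
* `isInt_lcmUpto_cube_mul_constTerm` — `D_{2n-1}³ · Σ_{o<3} Σ_{k≤n} (-1)^k c_{o,k} Σ_{l<k}(-1)^l/(l+½)^{o+1} ∈ ℤ`
  for data with `IsInt 3 D_n c` (so `2^{4n} D_{2n-1}³ V_n ∈ ℤ`).

Everything is PROVED (0 sorry); no named facts. The identification `u_n = U'_n/8`, `v_n = V_n/8`
(Lemma 5) is not in this file.
-/

noncomputable section

open Finset
open Literature.NumberTheory.Transcendental

namespace Literature.NumberTheory.Irrationality.Zudilin2003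

/-! ### The coefficient sums -/

/-- `d^{2-o} Σ_{k≤n} (-1)^k c_{o,k} ∈ ℤ` for data with `d^{2-o}c_{o,k} ∈ ℤ`.
[cite: Zudilin2003Catalan, Sect. 2, Lemma 1, eqs. (16), (18)] -/
theorem isInt_dpow_mul_altSum (n d : ℕ) (c : ℕ → ℕ → ℚ) (hint : BallRivoal.IsInt 3 d c)
    (o : ℕ) : ∃ z : ℤ, (d : ℚ) ^ (2 - o) * ∑ k ∈ range (n + 1), (-1) ^ k * c o k = z := by
  have hk : ∀ k ∈ range (n + 1), ∃ z : ℤ, (d : ℚ) ^ (2 - o) * ((-1) ^ k * c o k) = z := by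
    intro k _
    obtain ⟨w, hw⟩ := hint o k
    refine ⟨(-1) ^ k * w, ?_⟩
    rw [show (3 : ℕ) - 1 - o = 2 - o by omega] at hw
    push_cast
    rw [← hw]
    ring
  choose z hz using hk
  refine ⟨∑ k ∈ (range (n + 1)).attach, z k.1 k.2, ?_⟩
  rw [mul_sum, ← sum_attach]
  push_cast
  exact sum_congr rfl fun k _ => hz k.1 k.2

/-! ### The alternating half-integer partial sums -/

/-- `Σ_{l<k} (-1)^l/(l+½)^s` (`= 2^s Σ_{l<k} (-1)^l/(2l+1)^s`), the truncations of `2^s β(s)` entering (19).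
[cite: Zudilin2003Catalan, Sect. 2, eq. (19)] -/
def altHalfPartial (s k : ℕ) : ℚ := ∑ l ∈ range k, (-1) ^ l / ((l : ℚ) + 1 / 2) ^ s

/-- `(2l+1) ∣ D_{2n-1}` for `l < n`. [folklore] -/
private theorem two_mul_add_one_dvd_lcmUpto {l n : ℕ} (hl : l < n) :
    ((2 * l + 1 : ℕ) : ℤ) ∣ ((Nat.lcmUpto (2 * n - 1) : ℕ) : ℤ) := by
  have hmem : 2 * l + 1 ∈ Icc 1 (2 * n - 1) := mem_Icc.2 ⟨by omega, by omega⟩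
  have h := Finset.dvd_lcm (f := id) hmem
  have h' : 2 * l + 1 ∣ Nat.lcmUpto (2 * n - 1) := by simpa [Nat.lcmUpto] using h
  exact_mod_cast h'

/-- **`D_{2n-1}^s Σ_{l<k} (-1)^l/(l+½)^s ∈ ℤ` for `k ≤ n`** (the display after (19):
`D_{2n-1}^{3-j} Σ_{l<k} (-1)^l/(2l+1)^{3-j} ∈ ℤ`). [cite: Zudilin2003Catalan, Sect. 2, Lemma 1 (after (19))] -/
theorem isInt_lcmUpto_pow_mul_altHalfPartial (n s k : ℕ) (hk : k ≤ n) :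
    ∃ z : ℤ, ((Nat.lcmUpto (2 * n - 1) : ℕ) : ℚ) ^ s * altHalfPartial s k = z := by
  have hl : ∀ l ∈ range k, ∃ z : ℤ,
      ((Nat.lcmUpto (2 * n - 1) : ℕ) : ℚ) ^ s * ((-1) ^ l / ((l : ℚ) + 1 / 2) ^ s) = z := by
    intro l hlmem
    have hl' : l < n := (mem_range.1 hlmem).trans_le hk
    obtain ⟨w, hw⟩ := two_mul_add_one_dvd_lcmUpto hl'
    refine ⟨(-1) ^ l * (2 * w) ^ s, ?_⟩
    have hwq : ((Nat.lcmUpto (2 * n - 1) : ℕ) : ℚ) = ((2 * l + 1 : ℕ) : ℚ) * w := by exact_mod_cast hw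
    have hhalf : ((l : ℚ) + 1 / 2) = ((2 * l + 1 : ℕ) : ℚ) / 2 := by push_cast; ring
    rw [hwq, hhalf, mul_pow, div_pow]
    have : (((2 * l + 1 : ℕ) : ℚ)) ≠ 0 := by positivity
    field_simp
    push_cast
    ring
  choose z hz using hl
  refine ⟨∑ l ∈ (range k).attach, z l.1 l.2, ?_⟩
  rw [altHalfPartial, mul_sum, ← sum_attach]
  push_cast
  exact sum_congr rfl fun l _ => hz l.1 l.2

/-- `D_n ∣ D_{2n-1}` for `n ≥ 1`. [folklore] -/
private theorem lcmUpto_dvd_lcmUpto_two_mul_sub_one {n : ℕ} (hn : 1 ≤ n) :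
    Nat.lcmUpto n ∣ Nat.lcmUpto (2 * n - 1) := by
  unfold Nat.lcmUpto
  refine Finset.lcm_dvd fun b hb => ?_
  have hb' := mem_Icc.1 hb
  exact Finset.dvd_lcm (f := id) (mem_Icc.2 ⟨hb'.1, by omega⟩)

/-- **`D_{2n-1}³ · Σ_{o<3} Σ_{k≤n} (-1)^k c_{o,k} Σ_{l<k} (-1)^l/(l+½)^{o+1} ∈ ℤ`** for data with
`D_n^{2-o} c_{o,k} ∈ ℤ` (`n ≥ 1`): the inclusion `2^{4n} D_{2n-1}³ V_n ∈ ℤ` of Lemma 1.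
[cite: Zudilin2003Catalan, Sect. 2, Lemma 1, eqs. (16), (19)] -/
theorem isInt_lcmUpto_cube_mul_constTerm (n : ℕ) (hn : 1 ≤ n) (c : ℕ → ℕ → ℚ)
    (hint : BallRivoal.IsInt 3 (Nat.lcmUpto n) c) :
    ∃ z : ℤ, ((Nat.lcmUpto (2 * n - 1) : ℕ) : ℚ) ^ 3 *
      ∑ o ∈ range 3, ∑ k ∈ range (n + 1), (-1) ^ k * c o k * altHalfPartial (o + 1) k = z := by
  obtain ⟨e, he⟩ := lcmUpto_dvd_lcmUpto_two_mul_sub_one hn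
  have hE : ((Nat.lcmUpto (2 * n - 1) : ℕ) : ℚ) = ((Nat.lcmUpto n : ℕ) : ℚ) * (e : ℚ) := by
    exact_mod_cast he
  have hterm : ∀ o ∈ range 3, ∀ k ∈ range (n + 1), ∃ z : ℤ,
      ((Nat.lcmUpto (2 * n - 1) : ℕ) : ℚ) ^ 3 * ((-1) ^ k * c o k * altHalfPartial (o + 1) k) = z := by
    intro o ho k hk
    have ho' : o < 3 := mem_range.1 ho
    have hk' : k ≤ n := Nat.lt_succ_iff.1 (mem_range.1 hk)
    obtain ⟨w, hw⟩ := hint o k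
    obtain ⟨v, hv⟩ := isInt_lcmUpto_pow_mul_altHalfPartial n (o + 1) k hk'
    refine ⟨(-1) ^ k * (e : ℤ) ^ (2 - o) * w * v, ?_⟩
    rw [show (3 : ℕ) - 1 - o = 2 - o by omega] at hw
    have hsplit : ((Nat.lcmUpto (2 * n - 1) : ℕ) : ℚ) ^ 3
        = (((Nat.lcmUpto n : ℕ) : ℚ) ^ (2 - o) * (e : ℚ) ^ (2 - o))
          * ((Nat.lcmUpto (2 * n - 1) : ℕ) : ℚ) ^ (o + 1) := by
      rw [← mul_pow, ← hE, ← pow_add]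
      congr 1
      omega
    rw [hsplit]
    calc (((Nat.lcmUpto n : ℕ) : ℚ) ^ (2 - o) * (e : ℚ) ^ (2 - o))
          * ((Nat.lcmUpto (2 * n - 1) : ℕ) : ℚ) ^ (o + 1) * ((-1) ^ k * c o k * altHalfPartial (o + 1) k)
        = (-1) ^ k * (e : ℚ) ^ (2 - o) * ((((Nat.lcmUpto n : ℕ) : ℚ)) ^ (2 - o) * c o k)
          * (((Nat.lcmUpto (2 * n - 1) : ℕ) : ℚ) ^ (o + 1) * altHalfPartial (o + 1) k) := by ring
      _ = _ := by rw [hw, hv]; push_cast; ring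
  choose z hz using hterm
  refine ⟨∑ o ∈ (range 3).attach, ∑ k ∈ (range (n + 1)).attach, z o.1 o.2 k.1 k.2, ?_⟩
  rw [mul_sum, ← sum_attach]
  push_cast
  refine sum_congr rfl fun o _ => ?_
  rw [mul_sum, ← sum_attach]
  exact sum_congr rfl fun k _ => hz o.1 o.2 k.1 k.2

end Literature.NumberTheory.Irrationality.Zudilin2003
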